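import Literature.NumberTheory.Rogawski1990.ArchStableOrbitalWallEndStateSigned   -- ★ (D3) (F0P3a-p07): the e-SIGNED end state; brings ★ (D2-comb) `ArchStableOrbitalWallClassRegrouping`, ★ (D2-eval) `ArchStableOrbitalWallCoefficients`
import HarnessLib

/-!
# THE κ-SIGNED END STATE OF THE «METHOD OF §8.2» ON ONE DIAGONAL CARRIER IS THE UNSIGNED STABLE SUM: `Σ_ρ (Π_v sgn(re σ_v α_{ρ_v⁻¹1})·κ_v(ρ_v))·K⁻¹·I(ρ) = (Π_v 2M_v·Π_i sgn α_i) · Φ^st_∞(t z⁰, a)`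
# ((E-alg) of the U6 G′ package — the endoscopic κ-sign CANCELS the Kottwitz sign class by class; Rogawski 1990 §8.2 Prop. 8.2.1 p. 118 «`Φ^κ(γ₀, f) = Φ(γ₀, f) + Φ(γ₀′, f)`», p. 124)

Topic `NumberTheory/Rogawski1990`; namespace `Literature.NumberTheory.Rogawski1990`.  THEOREMS ONLY (no `def`, no instance, no notation, no axiom, no named fact, no `sorry`); finite
book-keeping over ★ (D2-comb)∕(D2-eval) (F0P3a-p07∕p05).  Cell `pub/hodgecm-mathlib`, HCML Track B «K2-LIT», ENGINE E4 unit U6 `ArchLimitConstant` (crux H413 = `stmt-HodgeConjecture-24833`),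
socket #9 `sig_K2E4ExplicitArchSingularTransfer` — brick **(E-alg)** of the G′ package (K2E4-p11 ask 2026-09-03T22:10:30Z, for G4 = (end) `Theorems/K2E4ArchGStateEnd.lean`); author K2E4-p13 (g0).

THE MATHEMATICS.  ★ (D3) `sum_prod_wallCoef_mul_eq_prod_mul_archStableOrbitalIntegral` evaluates the SYMMETRIC end state of the place induction at a split-singular wall point `t z⁰`
(`z⁰_{v,0} = z⁰_{v,2} ≠ z⁰_{v,1}`): with the wall weights `κ_v(σ) = (cw_v σ ? 2 : c_v σ⁻¹)`, `λ_v(σ) = (cw_v σ ? mass_v σ : 1)` (`cw_v σ :⇔ 0 < re σ_v α_{σ⁻¹0} · re σ_v α_{σ⁻¹2}`, the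
COMPACT-centraliser case) and the analytic values `c_v = −M_v`, `mass_v = M_v`, every per-place fibre sum is `−2M_v·p_v!(3−p_v)!·e_v(class)` and the total is `(Π_v −2M_v) · Φ^{st,e}_∞(t z⁰, a)` — the
Kottwitz-SIGNED stable sum.  On the ENDOSCOPIC side of (4.3.1) each relabelled partner carries, in addition, Rogawski's sign `κ_v = sgn(re σ_v α_{ρ_v⁻¹ 1})·η_v` (★ (Δ-def-explicit), ★ G2
`K2E4ArchWallDeltaFactor`: the slot `ρ_v⁻¹ 1` holds the `U(Φ₁)`-eigenvalue).  KEY SIGN LEMMA (S): for real non-zero weights,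
`sgn(re α_{σ⁻¹1}) · (cw σ ? −1 : 1) = −Π_i sgn(re α_i)` (the product of the three signs is permutation-invariant and `sgn α_{σ⁻¹0}·sgn α_{σ⁻¹2} = (cw σ ? 1 : −1)`), i.e. the κ-sign is
`−(Π_i sgn α_i) · e_v(class)` (★ `kottwitzSign_diagonal_circle_comp_perm_cast_eq_ite`), so it CANCELS the Kottwitz sign of (D2-eval): every fibre sum of `sgn·κ·λ` is the r-FREE constant
`2M_v·p_v!(3−p_v)!·Π_i sgn(re σ_v α_i)` and the regrouping gives the UNSIGNED stable sum — print's «`Φ^κ(γ₀, f)` is equal to `Φ(γ₀, f) + Φ(γ₀′, f)`» (p. 118, the κ-combination at the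
semiregular `γ₀` is the plain sum over the stable class).  (`η_v = archMajoritySign` is a `ρ`-free overall sign and is factored OUT — not touched here.)

* §1 `ite_pos_mul_eq_neg_sign_mul_sign` (`(0 < ab ? −1 : 1) = −sgn a·sgn b`), **`sign_mul_ite_cw_eq_neg_prod_sign`** (lemma (S)), `sign_eq_neg_prod_sign_mul_ite` (solved for the κ-sign).
* §2 **`sum_filter_sign_mul_wallWeight_eq_two_mul_mul_prod_sign`** — the κ-signed per-place fibre sum `= 2M·p!(3−p)!·Π_i sgn α_i` (r-free; twin of ★ `sum_filter_wallWeight_eq_neg_two_mul_mul_kottwitzSign`).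
* §3 `sum_univ_prod_smul_mk_archDiagTorus_comp_eq_prod_smul_sum_image_of_fibre_const`, **`sum_univ_prod_mul_classOrbitalIntegral_mk_archDiagTorus_comp_eq_prod_mul_archStableOrbitalIntegral_of_fibre_const`**
  — regrouping with CONSTANT fibre sums gives `(Π_v Λ_v) · Φ^st_∞(t z, a)` UNSIGNED (★ `archStableOrbitalIntegral_archDiagTorus_eq_sum_of_conj`; any `N`).
* §4 **`sum_prod_sign_mul_wallCoef_mul_eq_prod_mul_archStableOrbitalIntegral`** — THE κ-SIGNED END STATE (binders of ★ (D3) VERBATIM; LHS with the extra factor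
  `((sign (re σ_v α_{(ρ v).symm 1}) : ℤ) : ℂ) *` inside `Π_v`; conclusion `(Π_v 2·M_v·Π_i sgn(re σ_v α_i)) · archStableOrbitalIntegral … m a (t z⁰)`).
HONEST LABEL: HC_CM is proved only modulo the 7 printed citations (2 remaining named inputs: hLiu418 = stmt-HodgeConjecture-24832, h413 = stmt-HodgeConjecture-24833) until rung 0 closes; this
file is algebra over ★ bricks and pays nothing by itself.

## References
* [Rogawski1990] J. D. Rogawski, *Automorphic Representations of Unitary Groups in Three Variables*, Ann. of Math. Stud. 123 (1990), §8.2 Prop. 8.2.1 p. 118 (`Φ^κ(γ₀, f) = Φ(γ₀, f) + Φ(γ₀′, f)`),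
  pp. 122–124, §14.5 Lemma 14.5.2 (b) pp. 238–239, §14.6 p. 242 (`κ = ±1`), §4.1 (4.1.2) p. 39.
* [BrockerTomDieck1985] Th. Bröcker, T. tom Dieck, *Representations of Compact Lie Groups*, GTM 98 (1985), IV (3.2).
-/

set_option autoImplicit false

noncomputable section

open Matrix Equiv Finset NumberField NumberField.InfinitePlace
open Literature.LinearAlgebra.Matrix Literature.NumberTheory.Automorphic Literature.NumberTheory.Automorphic.UnitaryGroup
open scoped MatrixGroups ComplexConjugate NNReal

namespace Literature.NumberTheory.Rogawski1990

/-! ## §1 The sign lemma (S) -/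

/-- For non-zero reals `a, b`: `(0 < ab ? −1 : 1) = −sgn a · sgn b` (in `ℂ`). [cite: Rogawski1990, §8.2 p. 117] -/
theorem ite_pos_mul_eq_neg_sign_mul_sign {a b : ℝ} (ha : a ≠ 0) (hb : b ≠ 0) :
    (if 0 < a * b then (-1 : ℂ) else 1) = -((((SignType.sign a : ℤ)) : ℂ) * (((SignType.sign b : ℤ)) : ℂ)) := by
  rcases ha.lt_or_gt with ha' | ha' <;> rcases hb.lt_or_gt with hb' | hb'
  · rw [if_pos (mul_pos_of_neg_of_neg ha' hb'), sign_neg ha', sign_neg hb']; norm_num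
  · rw [if_neg (not_lt.2 (mul_neg_of_neg_of_pos ha' hb').le), sign_neg ha', sign_pos hb']; norm_num
  · rw [if_neg (not_lt.2 (mul_neg_of_pos_of_neg ha' hb').le), sign_pos ha', sign_neg hb']; norm_num
  · rw [if_pos (mul_pos ha' hb'), sign_pos ha', sign_pos hb']; norm_num

/-- **LEMMA (S)**: for real non-zero weights `e` and every relabelling `σ ∈ S₃`, `sgn(e_{σ⁻¹1}) · (cw σ ? −1 : 1) = −Π_i sgn(e_i)`, `cw σ :⇔ 0 < e_{σ⁻¹0}·e_{σ⁻¹2}` — the product of the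
three signs is permutation-invariant and the two coalescing slots contribute `(cw ? 1 : −1)`. [cite: Rogawski1990, §8.2 Prop. 8.2.1 p. 118; §14.6 p. 242] -/
theorem sign_mul_ite_cw_eq_neg_prod_sign (e : Fin 3 → ℝ) (he : ∀ i, e i ≠ 0) (σ : Perm (Fin 3)) :
    (((SignType.sign (e (σ⁻¹ 1)) : ℤ)) : ℂ) * (if 0 < e (σ⁻¹ 0) * e (σ⁻¹ 2) then (-1 : ℂ) else 1) =
      -∏ i : Fin 3, (((SignType.sign (e i) : ℤ)) : ℂ) := by
  rw [ite_pos_mul_eq_neg_sign_mul_sign (he _) (he _),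
    ← Equiv.prod_comp σ⁻¹ (fun i : Fin 3 => (((SignType.sign (e i) : ℤ)) : ℂ)), Fin.prod_univ_three]
  ring

/-- Lemma (S) solved for the κ-sign: `sgn(e_{σ⁻¹1}) = −(Π_i sgn e_i) · (cw σ ? −1 : 1)` (the factor `(cw ? −1 : 1)` squares to `1`). [cite: Rogawski1990, §8.2 Prop. 8.2.1 p. 118; §14.6 p. 242] -/
theorem sign_eq_neg_prod_sign_mul_ite (e : Fin 3 → ℝ) (he : ∀ i, e i ≠ 0) (σ : Perm (Fin 3)) :
    (((SignType.sign (e (σ⁻¹ 1)) : ℤ)) : ℂ) =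
      (-∏ i : Fin 3, (((SignType.sign (e i) : ℤ)) : ℂ)) * (if 0 < e (σ⁻¹ 0) * e (σ⁻¹ 2) then (-1 : ℂ) else 1) := by
  rw [← sign_mul_ite_cw_eq_neg_prod_sign e he σ, mul_assoc]
  split_ifs <;> ring

/-! ## §2 The κ-signed per-place fibre sum is the r-free constant `2M·p!(3−p)!·Π_i sgn α_i` -/

section Place

variable (L : Type) [Field L] (α : Fin 3 → L) (w : {w : InfinitePlace L // IsComplex w})

open scoped Classical in
/-- **THE κ-SIGNED CLASS COEFFICIENT.**  Twin of ★ (D2-eval) `sum_filter_wallWeight_eq_neg_two_mul_mul_kottwitzSign` with the endoscopic sign `sgn(re σ_w α_{σ⁻¹1})` in front of the wall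
weight: for every `r ∈ S₃`, `Σ_{σ : ⟦diag(z⁰∘σ)⟧ = ⟦diag(z⁰∘r)⟧} sgn(re σ_w α_{σ⁻¹1}) · (cw σ ? 2 : c σ) · (cw σ ? mass σ : 1) = 2M·p!(3−p)!·Π_i sgn(re σ_w α_i)` — INDEPENDENT of `r`: on the fibre the
summand is `−(Π sgn α)·(cw ? −1 : 1)·(cw ? 2M : −M) = (Π sgn α)·(cw ? 2M : M)` (lemma (S), `cw` a class function ★ `pos_iff_pos_of_mk_circleDiagonal_comp_eq`) and the count is
`(cw ? p!(3−p)! : 2·p!(3−p)!)` (★ `card_filter_mk_circleDiagonal_comp_wall_eq`). [cite: Rogawski1990, §8.2 Prop. 8.2.1 p. 118, pp. 123–124; §14.6 p. 242] -/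
theorem sum_filter_sign_mul_wallWeight_eq_two_mul_mul_prod_sign (hα : ∀ i, α i ≠ 0) (hreal : ∀ i, (w.1.embedding (α i)).im = 0)
    {z₀ : Fin 3 → Circle} (h02 : z₀ 0 = z₀ 2) (h01 : z₀ 0 ≠ z₀ 1)
    (cst : Perm (Fin 3) → ℂ) (mass : Perm (Fin 3) → ℝ≥0) (M : ℝ)
    (hC : ∀ σ : Perm (Fin 3), ¬ 0 < (w.1.embedding (α (σ⁻¹ 0))).re * (w.1.embedding (α (σ⁻¹ 2))).re → cst σ = -M)
    (hM : ∀ σ : Perm (Fin 3), 0 < (w.1.embedding (α (σ⁻¹ 0))).re * (w.1.embedding (α (σ⁻¹ 2))).re → ((mass σ : ℝ≥0) : ℝ) = M)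
    (r : Perm (Fin 3)) :
    ∑ σ ∈ univ.filter (fun σ : Perm (Fin 3) =>
        ConjClasses.mk (⟨circleDiagonal 3 (z₀ ∘ ⇑σ), circleDiagonal_mem_archLocal_diagonal L 3 α w (z₀ ∘ ⇑σ)⟩ : archLocal L 3 (diagonal α) w) =
          ConjClasses.mk (⟨circleDiagonal 3 (z₀ ∘ ⇑r), circleDiagonal_mem_archLocal_diagonal L 3 α w (z₀ ∘ ⇑r)⟩ : archLocal L 3 (diagonal α) w)),
        (((SignType.sign ((w.1.embedding (α (σ.symm 1))).re) : ℤ) : ℂ) *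
          ((if 0 < (w.1.embedding (α (σ⁻¹ 0))).re * (w.1.embedding (α (σ⁻¹ 2))).re then (2 : ℂ) else cst σ) *
            (((if 0 < (w.1.embedding (α (σ⁻¹ 0))).re * (w.1.embedding (α (σ⁻¹ 2))).re then mass σ else 1 : ℝ≥0) : ℝ) : ℂ))) =
      (2 : ℂ) * M * ((univ.filter fun i => 0 < (w.1.embedding (α i)).re).card.factorial *
          (3 - (univ.filter fun i => 0 < (w.1.embedding (α i)).re).card).factorial : ℕ) *
        ∏ i : Fin 3, (((SignType.sign ((w.1.embedding (α i)).re) : ℤ)) : ℂ) := by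
  have he : ∀ i, (w.1.embedding (α i)).re ≠ 0 := fun i => re_embedding_ne_zero L 3 α w hα hreal i
  -- on the fibre the summand is the constant `(Π sgn α) · (cw r ? 2M : M)`
  have hconst : ∀ σ ∈ univ.filter (fun σ : Perm (Fin 3) =>
        ConjClasses.mk (⟨circleDiagonal 3 (z₀ ∘ ⇑σ), circleDiagonal_mem_archLocal_diagonal L 3 α w (z₀ ∘ ⇑σ)⟩ : archLocal L 3 (diagonal α) w) =
          ConjClasses.mk (⟨circleDiagonal 3 (z₀ ∘ ⇑r), circleDiagonal_mem_archLocal_diagonal L 3 α w (z₀ ∘ ⇑r)⟩ : archLocal L 3 (diagonal α) w)),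
      (((SignType.sign ((w.1.embedding (α (σ.symm 1))).re) : ℤ) : ℂ) *
          ((if 0 < (w.1.embedding (α (σ⁻¹ 0))).re * (w.1.embedding (α (σ⁻¹ 2))).re then (2 : ℂ) else cst σ) *
            (((if 0 < (w.1.embedding (α (σ⁻¹ 0))).re * (w.1.embedding (α (σ⁻¹ 2))).re then mass σ else 1 : ℝ≥0) : ℝ) : ℂ))) =
        (∏ i : Fin 3, (((SignType.sign ((w.1.embedding (α i)).re) : ℤ)) : ℂ)) *
          (if 0 < (w.1.embedding (α (r⁻¹ 0))).re * (w.1.embedding (α (r⁻¹ 2))).re then 2 * (M : ℂ) else (M : ℂ)) := by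
    intro σ hσ
    have hiff := pos_iff_pos_of_mk_circleDiagonal_comp_eq L α w hα hreal h02 h01 (Finset.mem_filter.mp hσ).2
    have hsgn := sign_eq_neg_prod_sign_mul_ite (fun i => (w.1.embedding (α i)).re) he σ
    rw [show σ.symm 1 = σ⁻¹ 1 from rfl, hsgn]
    by_cases hr : 0 < (w.1.embedding (α (r⁻¹ 0))).re * (w.1.embedding (α (r⁻¹ 2))).re
    · have hs : 0 < (w.1.embedding (α (σ⁻¹ 0))).re * (w.1.embedding (α (σ⁻¹ 2))).re := hiff.mpr hr
      rw [if_pos hs, if_pos hs, if_pos hs, if_pos hr, hM σ hs]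
      push_cast
      ring
    · have hs : ¬ 0 < (w.1.embedding (α (σ⁻¹ 0))).re * (w.1.embedding (α (σ⁻¹ 2))).re := fun h => hr (hiff.mp h)
      rw [if_neg hs, if_neg hs, if_neg hs, if_neg hr, hC σ hs]
      push_cast
      ring
  rw [Finset.sum_congr rfl hconst, Finset.sum_const, card_filter_mk_circleDiagonal_comp_wall_eq L α w hα hreal h02 h01 r, nsmul_eq_mul]
  split_ifs with hP <;> push_cast <;> ring

end Place

/-! ## §3 Regrouping with CONSTANT fibre sums: the UNSIGNED stable sum -/

section Torus

variable (L : Type) [Field L] [NumberField L] [IsCMField L] (N : ℕ) (α : Fin N → L)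

open scoped Classical in
/-- **CONSTANT FIBRE SUMS GIVE THE UNSIGNED CLASS SUM.**  If at every place `v` and every `r ∈ S_N` the fibre sum of the weight is the r-free constant `Λ_v`,
`Σ_{σ : ⟦diag(z_v∘σ)⟧ = ⟦diag(z_v∘r)⟧} w_v σ = Λ_v`, then `Σ_ρ (Π_v w_v(ρ_v)) • G(⟦t(z∘ρ)⟧) = (Π_v Λ_v) • Σ_{q ∈ image} G q` (★ (D2-comb) regrouping + ★ box structure of the fibres).
[cite: Rogawski1990, §4.1 (4.1.1) p. 39; §8.2 Prop. 8.2.1 p. 118] -/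
theorem sum_univ_prod_smul_mk_archDiagTorus_comp_eq_prod_smul_sum_image_of_fibre_const {M : Type*} [AddCommMonoid M] [Module ℂ M]
    (z : {w : InfinitePlace L // IsComplex w} → Fin N → Circle) (wt : {w : InfinitePlace L // IsComplex w} → Perm (Fin N) → ℂ)
    (Λ : {w : InfinitePlace L // IsComplex w} → ℂ)
    (hΛ : ∀ (v : {w : InfinitePlace L // IsComplex w}) (r : Perm (Fin N)),
      ∑ σ ∈ univ.filter (fun σ : Perm (Fin N) =>
        ConjClasses.mk (⟨circleDiagonal N (z v ∘ σ), circleDiagonal_mem_archLocal_diagonal L N α v (z v ∘ σ)⟩ : archLocal L N (diagonal α) v) =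
          ConjClasses.mk (⟨circleDiagonal N (z v ∘ r), circleDiagonal_mem_archLocal_diagonal L N α v (z v ∘ r)⟩ : archLocal L N (diagonal α) v)), wt v σ = Λ v)
    (G : ConjClasses ↥(arch (↥(maximalRealSubfield L)) L (IsCMField.complexConj L) N (diagonal α)) → M) :
    ∑ ρ : {w : InfinitePlace L // IsComplex w} → Perm (Fin N), (∏ v, wt v (ρ v)) • G (ConjClasses.mk (archDiagTorus L N α fun w => z w ∘ ρ w)) =
      (∏ v, Λ v) • ∑ q ∈ univ.image (fun ρ : {w : InfinitePlace L // IsComplex w} → Perm (Fin N) => ConjClasses.mk (archDiagTorus L N α fun w => z w ∘ ρ w)), G q := by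
  rw [sum_univ_prod_smul_mk_archDiagTorus_comp_eq_sum_image L N α z wt G, smul_sum]
  refine sum_congr rfl fun q hq => ?_
  obtain ⟨r, -, rfl⟩ := mem_image.1 hq
  rw [sum_filter_mk_archDiagTorus_comp_prod_eq_prod_sum_filter L N α z wt r]
  congr 1
  exact prod_congr rfl fun v _ => hΛ v (r v)

variable [∀ g : ↥(arch (↥(maximalRealSubfield L)) L (IsCMField.complexConj L) N (diagonal α)),
    MeasurableSpace (↥(arch (↥(maximalRealSubfield L)) L (IsCMField.complexConj L) N (diagonal α)) ⧸
      Subgroup.centralizer ({g} : Set ↥(arch (↥(maximalRealSubfield L)) L (IsCMField.complexConj L) N (diagonal α))))]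

open scoped Classical in
/-- **… AND WITH `G = Φ(·, a; m)` THE SUM IS `(Π_v Λ_v) · Φ^st_∞(t z, a)` — UNSIGNED** (★ `archStableOrbitalIntegral_archDiagTorus_eq_sum_of_conj`: the stable class of `t z` is the image of
`ρ ↦ ⟦t(z∘ρ)⟧`; every family `m`, every `a`; `α_i ≠ 0`, `c α_i = α_i`). [cite: Rogawski1990, §4.1 (4.1.1) p. 39; §8.2 Prop. 8.2.1 p. 118, p. 124] -/
theorem sum_univ_prod_mul_classOrbitalIntegral_mk_archDiagTorus_comp_eq_prod_mul_archStableOrbitalIntegral_of_fibre_const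
    (hα : ∀ i, α i ≠ 0) (hherm : ∀ i, (IsCMField.complexConj L (α i) : L) = α i)
    (z : {w : InfinitePlace L // IsComplex w} → Fin N → Circle) (wt : {w : InfinitePlace L // IsComplex w} → Perm (Fin N) → ℂ)
    (Λ : {w : InfinitePlace L // IsComplex w} → ℂ)
    (hΛ : ∀ (v : {w : InfinitePlace L // IsComplex w}) (r : Perm (Fin N)),
      ∑ σ ∈ univ.filter (fun σ : Perm (Fin N) =>
        ConjClasses.mk (⟨circleDiagonal N (z v ∘ σ), circleDiagonal_mem_archLocal_diagonal L N α v (z v ∘ σ)⟩ : archLocal L N (diagonal α) v) =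
          ConjClasses.mk (⟨circleDiagonal N (z v ∘ r), circleDiagonal_mem_archLocal_diagonal L N α v (z v ∘ r)⟩ : archLocal L N (diagonal α) v)), wt v σ = Λ v)
    (m : OrbitalMeasureFamily ↥(arch (↥(maximalRealSubfield L)) L (IsCMField.complexConj L) N (diagonal α)))
    (a : ↥(arch (↥(maximalRealSubfield L)) L (IsCMField.complexConj L) N (diagonal α)) → ℂ) :
    ∑ ρ : {w : InfinitePlace L // IsComplex w} → Perm (Fin N), (∏ v, wt v (ρ v)) * classOrbitalIntegral m a (ConjClasses.mk (archDiagTorus L N α fun w => z w ∘ ρ w)) =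
      (∏ v, Λ v) * archStableOrbitalIntegral L N (diagonal α) m a (archDiagTorus L N α z) := by
  have h := sum_univ_prod_smul_mk_archDiagTorus_comp_eq_prod_smul_sum_image_of_fibre_const L N α z wt Λ hΛ (fun q => classOrbitalIntegral m a q)
  simp only [smul_eq_mul] at h
  rw [h, archStableOrbitalIntegral_archDiagTorus_eq_sum_of_conj L N α hα hherm z m a]

end Torus

/-! ## §4 The κ-signed end state on one diagonal carrier -/

section EndState

variable (L : Type) [Field L] [NumberField L] [IsCMField L] (α : Fin 3 → L)
  [∀ g : ↥(arch (↥(maximalRealSubfield L)) L (IsCMField.complexConj L) 3 (diagonal α)),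
    MeasurableSpace (↥(arch (↥(maximalRealSubfield L)) L (IsCMField.complexConj L) 3 (diagonal α)) ⧸
      Subgroup.centralizer ({g} : Set ↥(arch (↥(maximalRealSubfield L)) L (IsCMField.complexConj L) 3 (diagonal α))))]

open scoped Classical in
/-- **(E-alg) THE κ-SIGNED END STATE ON ONE DIAGONAL CARRIER IS THE UNSIGNED STABLE SUM.**  Binders of ★ (D3) `sum_prod_wallCoef_mul_eq_prod_mul_archStableOrbitalIntegral` VERBATIM
(`hα`, `hherm`, the wall point `z⁰` with `z⁰_v 0 = z⁰_v 2 ≠ z⁰_v 1`, the per-`ρ` reading `hI` of the end-state integrals, one noncompact constant `−M_v` (`hC`) and one compact mass `M_v` (`hM`)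
per place); the LHS carries the extra endoscopic sign `sgn(re σ_v α_{(ρ v)⁻¹ 1})` of every relabelled partner (★ (Δ-def-explicit) ∕ ★ G2's `K_ρ` with `η_v` factored out).  Conclusion:
`Σ_ρ (Π_v sgn(re σ_v α_{(ρ v)⁻¹1}) · (cw ? 2 : c v (ρ v)⁻¹)) · ((Π_v p_v!(3−p_v)!)⁻¹ · I ρ) = (Π_v 2·M_v·Π_i sgn(re σ_v α_i)) · archStableOrbitalIntegral … m a (t z⁰)` — NO Kottwitz
weight: the κ-sign and the Kottwitz sign cancel class by class (§2), print's «`Φ^κ(γ₀, f) = Φ(γ₀, f) + Φ(γ₀′, f)`».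
[cite: Rogawski1990, §8.2 Prop. 8.2.1 p. 118, p. 124; §14.5 Lemma 14.5.2 (b) pp. 238–239; §14.6 p. 242; §4.1 (4.1.2) p. 39] -/
theorem sum_prod_sign_mul_wallCoef_mul_eq_prod_mul_archStableOrbitalIntegral
    (hα : ∀ i, α i ≠ 0) (hherm : ∀ i, (IsCMField.complexConj L (α i) : L) = α i)
    (z0 : {w : InfinitePlace L // IsComplex w} → Fin 3 → Circle) (hwall : ∀ v, z0 v 0 = z0 v 2 ∧ z0 v 0 ≠ z0 v 1)
    (c : {w : InfinitePlace L // IsComplex w} → Perm (Fin 3) → ℂ) (mass : {w : InfinitePlace L // IsComplex w} → Perm (Fin 3) → ℝ≥0)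
    (M : {w : InfinitePlace L // IsComplex w} → ℝ)
    (hC : ∀ (v : {w : InfinitePlace L // IsComplex w}) (σ : Perm (Fin 3)),
      ¬ 0 < (v.1.embedding (α (σ⁻¹ 0))).re * (v.1.embedding (α (σ⁻¹ 2))).re → c v σ⁻¹ = -(M v : ℂ))
    (hM : ∀ (v : {w : InfinitePlace L // IsComplex w}) (σ : Perm (Fin 3)),
      0 < (v.1.embedding (α (σ⁻¹ 0))).re * (v.1.embedding (α (σ⁻¹ 2))).re → ((mass v σ : ℝ≥0) : ℝ) = M v)
    (m : OrbitalMeasureFamily ↥(arch (↥(maximalRealSubfield L)) L (IsCMField.complexConj L) 3 (diagonal α)))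
    (a : ↥(arch (↥(maximalRealSubfield L)) L (IsCMField.complexConj L) 3 (diagonal α)) → ℂ)
    (I : ({w : InfinitePlace L // IsComplex w} → Perm (Fin 3)) → ℂ)
    (hI : ∀ ρ : {w : InfinitePlace L // IsComplex w} → Perm (Fin 3),
      I ρ = ((∏ v : {w : InfinitePlace L // IsComplex w}, (if 0 < (v.1.embedding (α ((ρ v)⁻¹ 0))).re * (v.1.embedding (α ((ρ v)⁻¹ 2))).re then mass v (ρ v) else 1 : ℝ≥0) : ℝ≥0) : ℝ) •
        classOrbitalIntegral m a (ConjClasses.mk (archDiagTorus L 3 α fun w => z0 w ∘ ⇑(ρ w)))) :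
    ∑ ρ : {w : InfinitePlace L // IsComplex w} → Perm (Fin 3),
        (∏ v, (((SignType.sign ((v.1.embedding (α ((ρ v).symm 1))).re) : ℤ) : ℂ) *
          (if 0 < (v.1.embedding (α ((ρ v)⁻¹ 0))).re * (v.1.embedding (α ((ρ v)⁻¹ 2))).re then (2 : ℂ) else c v (ρ v)⁻¹))) *
          ((((∏ v : {w : InfinitePlace L // IsComplex w},
            (Finset.univ.filter fun i => 0 < (v.1.embedding (α i)).re).card.factorial *
              (3 - (Finset.univ.filter fun i => 0 < (v.1.embedding (α i)).re).card).factorial : ℕ) : ℂ)⁻¹ * I ρ)) =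
      (∏ v : {w : InfinitePlace L // IsComplex w}, ((2 : ℂ) * M v * ∏ i : Fin 3, (((SignType.sign ((v.1.embedding (α i)).re) : ℤ)) : ℂ))) *
        archStableOrbitalIntegral L 3 (diagonal α) m a (archDiagTorus L 3 α z0) := by
  have hreal : ∀ (v : {w : InfinitePlace L // IsComplex w}) (i : Fin 3), (v.1.embedding (α i)).im = 0 :=
    fun v i => im_embedding_eq_zero_of_complexConj_eq L v (hherm i)
  have hKne : ∀ v : {w : InfinitePlace L // IsComplex w}, (((Finset.univ.filter fun i => 0 < (v.1.embedding (α i)).re).card.factorial *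
      (3 - (Finset.univ.filter fun i => 0 < (v.1.embedding (α i)).re).card).factorial : ℕ) : ℂ) ≠ 0 := fun v => by
    exact_mod_cast (Nat.mul_ne_zero (Nat.factorial_ne_zero _) (Nat.factorial_ne_zero _))
  -- the weights `wt_v(σ) = sgn·κ_v(σ)·λ_v(σ)`, regrouped by §3 with the r-free coefficients of §2
  have hsum := sum_univ_prod_mul_classOrbitalIntegral_mk_archDiagTorus_comp_eq_prod_mul_archStableOrbitalIntegral_of_fibre_const L 3 α hα hherm z0
    (fun v σ => (((SignType.sign ((v.1.embedding (α (σ.symm 1))).re) : ℤ) : ℂ) *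
      ((if 0 < (v.1.embedding (α (σ⁻¹ 0))).re * (v.1.embedding (α (σ⁻¹ 2))).re then (2 : ℂ) else c v σ⁻¹) *
        (((if 0 < (v.1.embedding (α (σ⁻¹ 0))).re * (v.1.embedding (α (σ⁻¹ 2))).re then mass v σ else 1 : ℝ≥0) : ℝ) : ℂ))))
    (fun v => (2 : ℂ) * M v * ((Finset.univ.filter fun i => 0 < (v.1.embedding (α i)).re).card.factorial *
      (3 - (Finset.univ.filter fun i => 0 < (v.1.embedding (α i)).re).card).factorial : ℕ) * ∏ i : Fin 3, (((SignType.sign ((v.1.embedding (α i)).re) : ℤ)) : ℂ))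
    (fun v r => sum_filter_sign_mul_wallWeight_eq_two_mul_mul_prod_sign L α v hα (hreal v) (hwall v).1 (hwall v).2 (fun σ => c v σ⁻¹) (mass v) (M v)
      (hC v) (hM v) r)
    m a
  -- each summand through `hI`
  have hterm : ∀ ρ : {w : InfinitePlace L // IsComplex w} → Perm (Fin 3),
      (∏ v, (((SignType.sign ((v.1.embedding (α ((ρ v).symm 1))).re) : ℤ) : ℂ) *
          (if 0 < (v.1.embedding (α ((ρ v)⁻¹ 0))).re * (v.1.embedding (α ((ρ v)⁻¹ 2))).re then (2 : ℂ) else c v (ρ v)⁻¹))) *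
          ((((∏ v : {w : InfinitePlace L // IsComplex w},
            (Finset.univ.filter fun i => 0 < (v.1.embedding (α i)).re).card.factorial *
              (3 - (Finset.univ.filter fun i => 0 < (v.1.embedding (α i)).re).card).factorial : ℕ) : ℂ)⁻¹ * I ρ)) =
        (((∏ v : {w : InfinitePlace L // IsComplex w},
            (Finset.univ.filter fun i => 0 < (v.1.embedding (α i)).re).card.factorial *
              (3 - (Finset.univ.filter fun i => 0 < (v.1.embedding (α i)).re).card).factorial : ℕ) : ℂ)⁻¹ *
          ((∏ v, (((SignType.sign ((v.1.embedding (α ((ρ v).symm 1))).re) : ℤ) : ℂ) *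
            ((if 0 < (v.1.embedding (α ((ρ v)⁻¹ 0))).re * (v.1.embedding (α ((ρ v)⁻¹ 2))).re then (2 : ℂ) else c v (ρ v)⁻¹) *
            (((if 0 < (v.1.embedding (α ((ρ v)⁻¹ 0))).re * (v.1.embedding (α ((ρ v)⁻¹ 2))).re then mass v (ρ v) else 1 : ℝ≥0) : ℝ) : ℂ)))) *
            classOrbitalIntegral m a (ConjClasses.mk (archDiagTorus L 3 α fun w => z0 w ∘ ⇑(ρ w))))) := by
    intro ρ
    rw [hI ρ, Complex.real_smul, NNReal.coe_prod, Complex.ofReal_prod]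
    simp only [prod_mul_distrib]
    ring
  rw [Finset.sum_congr rfl fun ρ _ => hterm ρ, ← Finset.mul_sum, hsum, ← mul_assoc]
  congr 1
  have hKprod : (∏ v : {w : InfinitePlace L // IsComplex w}, (((Finset.univ.filter fun i => 0 < (v.1.embedding (α i)).re).card.factorial *
      (3 - (Finset.univ.filter fun i => 0 < (v.1.embedding (α i)).re).card).factorial : ℕ) : ℂ)) ≠ 0 :=
    prod_ne_zero_iff.mpr fun v _ => hKne v
  rw [Nat.cast_prod]
  simp only [prod_mul_distrib]
  rw [mul_comm ((∏ v : {w : InfinitePlace L // IsComplex w}, (2 : ℂ)) * ∏ v : {w : InfinitePlace L // IsComplex w}, (M v : ℂ))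
      (∏ v : {w : InfinitePlace L // IsComplex w}, (((Finset.univ.filter fun i => 0 < (v.1.embedding (α i)).re).card.factorial *
        (3 - (Finset.univ.filter fun i => 0 < (v.1.embedding (α i)).re).card).factorial : ℕ) : ℂ)),
    mul_assoc, ← mul_assoc, inv_mul_cancel₀ hKprod, one_mul]

end EndState

end Literature.NumberTheory.Rogawski1990

end
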